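import Summits.Ventures.AbcSig.Rows.Bridge
import Summits.Ventures.AbcSig.Rows.C2aL53A0V2
import Summits.Ventures.AbcSig.Rows.C2aL53A0V2AB

/-!
# Venture AbcSig — CELL `C2aL53A0V2`: the census statement `Rows.C2aCellRed 53 (fun a => a = 0) ∅` from the two row theorems

HONEST FRAMING. COMPUTATION cell `pub-abcsig`; CONDITIONAL theorem; no claim on ABC or any summit. Hypotheses exactly as in
`Rows/C2aL53A0V2.lean` and `Rows/C2aL53A0V2AB.lean`: `BS04Package` (CITED), `DataComplete` / `RefinesCPSymAll` (COMPUTED, certified level files;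
norm-form certificates), and the rows' per-orbit CITED exclusions universally quantified in the exponent
(shared by both distributions (a = 0: the second is the first with x, y swapped)). Conclusion = p1's census predicate (`Rows/Statements.lean`) with the residual of the row of
record `census/rows/T-BS13/C2a-l53-a0.md` (sha16 `cace2ecd2c3b9c8f`): all four coprime distributions `A·B = 2^0·53^m`, reduced exponents.
GENERATED by p-lean g4 `gen4/c2arow2.py` (pattern of `Rows/C2aL277A0XCell.lean`).
-/

namespace Summit.Ventures.AbcSig

/-- Cell `C2aL53A0V2`: `Rows.C2aCellRed 53 (fun a => a = 0) ∅` under the rows' hypotheses. -/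
theorem xcell_C2aL53A0V2 (M : NewformModel) (hP : M.BS04Package)
    (hD1696 : M.DataComplete 1696 level1696Orbits)
    (hD106 : M.DataComplete 106 level106Orbits)
    (hX_orbit_1696_12 : ∀ n m : ℕ, n ∈ ([17] : List ℕ) → M.Excludes 1696 orbit_1696_12 (famB (2 ^ 0 * 53 ^ m) n (fun _ _ => True))) :
    Rows.C2aCellRed 53 (fun a => a = 0) ∅ :=
  C2aCellRed_of_rows 53 (by norm_num) (by norm_num) _ _
    (fun n hn h11 hnℓ _ a m (ha : a = 0) han hm hmn x y z h1 h2 => by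
      subst ha
      exact xrow_C2aL53A0V2 M hP  hD1696 hD106 n hn h11 hnℓ  m hm hmn (hX_orbit_1696_12 n m) x y z h1 h2)
    (fun n hn h11 hnℓ _ a m (ha : a = 0) han hm hmn x y z h1 h2 => by
      subst ha
      exact xrow_C2aL53A0V2AB M hP  hD1696 hD106 n hn h11 hnℓ  m hm hmn (hX_orbit_1696_12 n m) x y z h1 h2)

end Summit.Ventures.AbcSig
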